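import Summits.BirchSwinnertonDyer.BirchSwinnertonDyer.Theorems.CMKolyvaginAtInertTwoPairSupplyClassesAtTwo
import Summits.BirchSwinnertonDyer.BirchSwinnertonDyer.Theorems.CMKolyvaginAtInertTwoPairDataInputsAtTwo
import Summits.BirchSwinnertonDyer.BirchSwinnertonDyer.Theorems.GenusKolyvaginAtTwoVisiblePairAtTwoCasselsTateKernel
import Summits.BirchSwinnertonDyer.BirchSwinnertonDyer.Theorems.GenusKolyvaginAtTwoPowDvdShaCardAtTwoRTRungDescentTwin
import Literature.NumberTheory.EllipticCurves.MordellCurveThreeDescentImage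
import HarnessLib

/-!
# Route `CMKolyvaginAtInertTwo`, crux `CMKolyvaginExactAtInertTwo` (stmt-BirchSwinnertonDyer-24277):
# SUPPLIER of the two-member data, III — the Heegner class `x = [2]_* ξ` over `ℚ` (`res ξ = δ_{M+1}(x₀)`,
# `2^{M₀} x₀ = y_K`): Selmer, of order `2^M`, a KUMMER class over `ℚ`, and `c'(1) = 2^{M₀} ξ`

Seat `bsd-line-cmk2-p1` g18 (cell `bsd-print-cf2`); helper (`--supports stmt-BirchSwinnertonDyer-24277`).
THEOREMS ONLY: no definition, no named fact, no `sorry`; no item is closed; BSD is not proved by this.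

The fields `x`, `x_mem`, `x_ord`, `c_one` of `PairDataM` (McCallum 1991 Lemma 5.1: `x = δ_M x₀` of order
`p^M`, `c_M(1) = p^{M₀} x`) for the `ℚ`-pair at `2`, built with the same level trick as the classes (file II):
with `x₀ ∈ E(K)`, `2^{M₀} x₀ = P` (`P = y_K`; g13 `…PairDataInputsAtTwo` for the conversions from the item's
`M₀`-clause) and Gross Prop. 5.3 (`σP − εP` torsion), the Kummer class `δ_{M+1}(x₀) ∈ H¹(K, E_K[2^{M+1}])` is an
`ε`-eigenclass (`conjAct_kummerMapTorsion_eq_smul_of_isOfFinAddOrder`), hence descends at level `2^{M+1}` to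
`ξ ∈ H¹(ℚ, E[2^{M+1}])` (`ε = 1`) or `y ∈ H¹(ℚ, E^{(d_K)}[2^{M+1}])` (`ε = −1`); the supplier's `x` is `[2]_* ξ`
(resp. `[2]_* y`):

* §1 `exists_resTorsion_eq_kummerMapTorsion` / `exists_hPsiKT_resTorsion_eq_kummerMapTorsion` — the descents;
* §2 `torsionH1ZSMul_mem_selmerGroup_of_resTorsion_eq_kummer` (`x ∈ Sel^{(2^M)}(E/ℚ)` — every place, incl.
  `q ∣ d_K`), `resTorsion_torsionH1ZSMul_eq_kummer` (`res x = δ_M(x₀)`), `zsmul_torsionH1ZSMul_ne_zero`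
  (`2^{M−1} x ≠ 0` from `2^{M₀+1} ∤ P`), and **`torsionH1ToH1_torsionH1ZSMul_eq_zero`: `x` DIES in `H¹(ℚ, E)`**,
  i.e. `x = δ_M(x₀')` for some `x₀' ∈ E(ℚ)` (`exists_rat_point_kummer_eq`) — the image `η` of `ξ` in `H¹(ℚ, E)`
  restricts to `0` in `H¹(K, E_K)`, so `2η = 0` (Serre I.§2.4 Cor.: `two_nsmul_mem_localRestrictionKer_of_tower` +
  `localRestrictionKer_self_eq_bot`), and `2η` is the image of `[2]_* ξ`; twin versions of all four (the Kummer kernels of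
  `E^{(d_K)}_K` and `E_K` correspond under `ψ`, gk2-p2 `torsionH1ToH1_hPsiKT_symm_eq_zero_iff`);
* §3 `cK_one_eq_kummerMapTorsion` (`c'_K(1) = δ_{M+1}(P)`) and `eq_zsmul_of_resTorsion_eq` /
  `eq_zsmul_of_hPsiKT_resTorsion_eq` (`c'(1) = 2^{M₀} ξ` by injectivity of the descent).

References: [McCallumLMS1991] §4 Lemma 4.6, §5 Lemma 5.1; [GrossLMS1991] §4 (4.1), Prop. 5.3, §5 (5.1);
[SerreGaloisCohomology1997] I.§2.4; [SilvermanAEC2009] VIII.§2, X.4.2.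
-/

-- single-conjunct summit: `Summit.BirchSwinnertonDyer.BirchSwinnertonDyer.…` repeats the name by design
set_option linter.dupNamespace false
set_option autoImplicit false

noncomputable section

open scoped Classical

namespace Summit.BirchSwinnertonDyer.BirchSwinnertonDyer.Theorems.KolyvaginPairSupplyTwo

open WeierstrassCurve NumberField IsDedekindDomain Field
open Literature.NumberTheory.EllipticCurves Literature.NumberTheory.GaloisRepresentations
open Literature.NumberTheory.EllipticCurves.KolyvaginDescent
open Summit.BirchSwinnertonDyer.Rank1Residual.P2.KolyvaginMachine
open Summit.BirchSwinnertonDyer.BirchSwinnertonDyer.Theorems.KolyvaginPairDataTwo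
open Summit.BirchSwinnertonDyer.BirchSwinnertonDyer.Theorems.GenusExact.VisiblePairAtTwo
open Summit.BirchSwinnertonDyer.BirchSwinnertonDyer.Theorems.GenusExact.EigenClassesFinite
open Summit.BirchSwinnertonDyer.BirchSwinnertonDyer.Theorems.GenusExact.PlusDescent

/-! ## §0 Levels -/

/-- `2^M · 2 = 2^{M+1}` in the level currency. [folklore] -/
theorem lvl_mul_two (M : ℕ) : (lvl M : ℤ) * 2 = lvl (M + 1) := by
  simp [lvl, pow_succ]

variable {N : ℕ} (W : WeierstrassCurve ℚ) {K : Type} [Field K] [NumberField K] (M : ℕ)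
  (hdiv' : ∀ Q : geomPoints (W.baseChange K), ∃ R, (lvl (M + 1) : ℤ) • R = Q)
  (hdivM : ∀ Q : geomPoints (W.baseChange K), ∃ R, (lvl M : ℤ) • R = Q)

/-! ## §1 The descents of `δ_{M+1}(x₀)` -/

section Descent

variable (h2 : Module.finrank ℚ K = 2) {θ : K} (hθ : θ ∉ Set.range (algebraMap ℚ K))
  (hd : θ ^ 2 = algebraMap ℚ K ((NumberField.discr K : ℤ) : ℚ))

/-- **`ε = 1`: `δ_{M+1}(x₀)` descends to `E` over `ℚ`.** With `E(K)` without `2`-torsion, `2^{M₀} x₀ = P` and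
`σP − P` torsion (Gross Prop. 5.3 with `ε = 1`), the Kummer class of `x₀` is `σ₀`-invariant, hence `res ξ` for a
(unique) `ξ ∈ H¹(ℚ, E[2^{M+1}])`. [cite: GrossLMS1991, Prop. 5.3 and §5 (5.1)] [cite: McCallumLMS1991, §5 Lemma 5.1] -/
theorem exists_resTorsion_eq_kummerMapTorsion
    (hL : ∀ Q : (W.baseChange K).toAffine.Point, (lvl (M + 1) : ℤ) • Q = 0 → Q = 0)
    (h2t : ∀ T : (W.baseChange K).toAffine.Point, (2 : ℤ) • T = 0 → T = 0)
    {x₀ P : (W.baseChange K).toAffine.Point} {M₀ : ℕ} (hx₀ : (((2 : ℕ) : ℤ) ^ M₀) • x₀ = P)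
    (htor : IsOfFinAddOrder (Affine.Point.map (W' := W) (sigmaQ K h2 hθ hd : K →ₐ[ℚ] K) P - (1 : ℤ) • P)) :
    ∃ ξ : galH1Torsion W (lvl (M + 1)),
      resTorsion W K (lvl (M + 1)) ξ = kummerMapTorsion (W.baseChange K) (lvl (M + 1)) hdiv' x₀ := by
  have hε := conjAct_kummerMapTorsion_eq_smul_of_isOfFinAddOrder W h2t (sigmaQ K h2 hθ hd) hdiv' hx₀ htor
  rw [one_zsmul] at hε
  exact (existsUnique_resTorsion_eq_of_conjAct_eq W K h2 hθ hd (lvl (M + 1)) hL hε).exists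

/-- **`ε = −1`: `δ_{M+1}(x₀)` descends to `E^{(d_K)}` over `ℚ`** (`σP + P` torsion): the Kummer class is
`σ₀`-anti-invariant, hence `ψ(res y)` for a (unique) `y ∈ H¹(ℚ, E^{(d_K)}[2^{M+1}])`.
[cite: GrossLMS1991, Prop. 5.3 and §5 (5.1)] [cite: Kolyvagin1989Izv, §3] -/
theorem exists_hPsiKT_resTorsion_eq_kummerMapTorsion
    (hL : ∀ Q : (W.baseChange K).toAffine.Point, (lvl (M + 1) : ℤ) • Q = 0 → Q = 0)
    (h2t : ∀ T : (W.baseChange K).toAffine.Point, (2 : ℤ) • T = 0 → T = 0)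
    {x₀ P : (W.baseChange K).toAffine.Point} {M₀ : ℕ} (hx₀ : (((2 : ℕ) : ℤ) ^ M₀) • x₀ = P)
    (htor : IsOfFinAddOrder (Affine.Point.map (W' := W) (sigmaQ K h2 hθ hd : K →ₐ[ℚ] K) P - (-1 : ℤ) • P)) :
    ∃ y : galH1Torsion (twin W K) (lvl (M + 1)),
      hPsiKT W K hθ hd (lvl (M + 1)) (resTorsion (twin W K) K (lvl (M + 1)) y) =
        kummerMapTorsion (W.baseChange K) (lvl (M + 1)) hdiv' x₀ := by
  have hε := conjAct_kummerMapTorsion_eq_smul_of_isOfFinAddOrder W h2t (sigmaQ K h2 hθ hd) hdiv' hx₀ htor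
  rw [neg_one_zsmul] at hε
  exact (exists_hPsiKT_resTorsion_eq_iff_conjAct_eq_neg W K h2 hθ hd (lvl (M + 1)) hL _).mpr hε

end Descent

/-! ## §2 The class `x = [2]_* ξ`: Selmer, restriction, order, and a Kummer class over `ℚ` -/

section Member

/-- **`[2]_* ξ ∈ Sel^{(2^M)}(E/ℚ)`** when `res ξ = δ_{M+1}(x₀)` (a Kummer class is Selmer over `K` at every place;
Dokchitser–Dokchitser's transfer for `[K : ℚ] = 2`). [cite: McCallumLMS1991, §5 Lemma 5.1] [cite: DokchitserDokchitserAnnals2010, Lemma 4.14 (proof)] -/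
theorem torsionH1ZSMul_mem_selmerGroup_of_resTorsion_eq_kummer (h2 : Module.finrank ℚ K = 2)
    {ξ : galH1Torsion W (lvl (M + 1))} {x₀ : (W.baseChange K).toAffine.Point}
    (hξ : resTorsion W K (lvl (M + 1)) ξ = kummerMapTorsion (W.baseChange K) (lvl (M + 1)) hdiv' x₀) :
    torsionH1ZSMul W 2 (lvl_succ_dvd M) ξ ∈ selmerGroup W (lvl M) :=
  torsionH1ZSMul_two_mem_selmerGroup_of_resTorsion_mem W K h2.le (lvl_succ_dvd M) (by
    rw [hξ]
    exact kummerMapTorsion_mem_selmerGroup (W.baseChange K) _ hdiv' x₀)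

/-- **`res ([2]_* ξ) = δ_M(x₀)`** (`[2]_* δ_{M+1} = δ_M`). [cite: McCallumLMS1991, §4 Lemma 4.6 and §5 Lemma 5.1] -/
theorem resTorsion_torsionH1ZSMul_eq_kummer
    {ξ : galH1Torsion W (lvl (M + 1))} {x₀ : (W.baseChange K).toAffine.Point}
    (hξ : resTorsion W K (lvl (M + 1)) ξ = kummerMapTorsion (W.baseChange K) (lvl (M + 1)) hdiv' x₀) :
    resTorsion W K (lvl M) (torsionH1ZSMul W 2 (lvl_succ_dvd M) ξ) =
      kummerMapTorsion (W.baseChange K) (lvl M) hdivM x₀ := by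
  rw [resTorsion_torsionH1ZSMul, hξ]
  exact torsionH1ZSMul_kummerMapTorsion (W.baseChange K) 2 (lvl_mul_two M) hdiv' hdivM x₀

/-- **`2^{M−1} · [2]_* ξ ≠ 0`** (`x` has order `2^M`) when `2^{M₀} x₀ = P` and `2^{M₀+1} ∤ P` in `E(K)` (no
`2`-torsion, `M ≥ 1`): otherwise `δ_M(2^{M−1} x₀) = 0`, i.e. `2^{M−1} x₀ ∈ 2^M E(K)`.
[cite: McCallumLMS1991, §5 Lemma 5.1] -/
theorem zsmul_torsionH1ZSMul_ne_zero (hdivM : ∀ Q : geomPoints (W.baseChange K), ∃ R, (lvl M : ℤ) • R = Q)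
    (h2t : ∀ T : (W.baseChange K).toAffine.Point, (2 : ℤ) • T = 0 → T = 0) (hM : 1 ≤ M) {ξ : galH1Torsion W (lvl (M + 1))} {x₀ P : (W.baseChange K).toAffine.Point} {M₀ : ℕ}
    (hξ : resTorsion W K (lvl (M + 1)) ξ = kummerMapTorsion (W.baseChange K) (lvl (M + 1)) hdiv' x₀)
    (hx₀ : (((2 : ℕ) : ℤ) ^ M₀) • x₀ = P)
    (hnd : ∀ Q : (W.baseChange K).toAffine.Point, (((2 : ℕ) : ℤ) ^ (M₀ + 1)) • Q ≠ P) :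
    (((2 : ℕ) : ℤ) ^ (M - 1)) • torsionH1ZSMul W 2 (lvl_succ_dvd M) ξ ≠ 0 := by
  intro h
  have h1 := congrArg (resTorsion W K (lvl M)) h
  rw [map_zsmul, resTorsion_torsionH1ZSMul_eq_kummer W M hdiv' hdivM hξ, map_zero, ← map_zsmul] at h1
  have hker : (((2 : ℕ) : ℤ) ^ (M - 1)) • x₀ ∈ (kummerMapTorsion (W.baseChange K) (lvl M) hdivM).ker := h1
  rw [kummerMapTorsion_ker, AddMonoidHom.mem_range] at hker
  obtain ⟨Q, hQ⟩ := hker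
  exact zsmul_ne_of_not_two_pow_succ_divisible W h2t hM hx₀ hnd Q hQ

/-- **`[2]_* ξ` DIES in `H¹(ℚ, E)`** when `res ξ` is a Kummer class over `K`: the image `η` of `ξ` restricts to
`0` in `H¹(K, E_K)`, so `2η = 0` over `ℚ` (`[K : ℚ] = 2`), and `2η` is the image of `[2]_* ξ`.
[cite: SerreGaloisCohomology1997, I.§2.4 Cor. to Prop. 9] [cite: SilvermanAEC2009, X.4.2] -/
theorem torsionH1ToH1_torsionH1ZSMul_eq_zero (h2 : Module.finrank ℚ K = 2)
    {ξ : galH1Torsion W (lvl (M + 1))} {x₀ : (W.baseChange K).toAffine.Point}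
    (hξ : resTorsion W K (lvl (M + 1)) ξ = kummerMapTorsion (W.baseChange K) (lvl (M + 1)) hdiv' x₀) :
    torsionH1ToH1 W (lvl M) (torsionH1ZSMul W 2 (lvl_succ_dvd M) ξ) = 0 := by
  have hη : resBaseChange W K (torsionH1ToH1 W (lvl (M + 1)) ξ) = 0 := by
    rw [← torsionH1ToH1_resTorsion, hξ, torsionH1ToH1_kummerMapTorsion]
  have hmem : torsionH1ToH1 W (lvl (M + 1)) ξ ∈ W.localRestrictionKer K := (mem_ker_resBaseChange_iff W K _).mp hη
  have h2η := two_nsmul_mem_localRestrictionKer_of_tower W (E := ℚ) h2.le hmem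
  rw [WeierstrassCurve.localRestrictionKer_self_eq_bot, AddSubgroup.mem_bot] at h2η
  rw [torsionH1ToH1_torsionH1ZSMul_two]
  exact h2η

/-- **`[2]_* ξ` is a Kummer class over `ℚ`**: `[2]_* ξ = δ_M(x₀')` for some `x₀' ∈ E(ℚ)` (Kummer exactness over
`ℚ`). [cite: SilvermanAEC2009, VIII.§2 and X.4.2] -/
theorem exists_rat_point_kummer_eq [W.IsElliptic] (h2 : Module.finrank ℚ K = 2)
    {ξ : galH1Torsion W (lvl (M + 1))} {x₀ : (W.baseChange K).toAffine.Point}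
    (hξ : resTorsion W K (lvl (M + 1)) ξ = kummerMapTorsion (W.baseChange K) (lvl (M + 1)) hdiv' x₀) :
    ∃ x₀' : W.toAffine.Point,
      kummerMapTorsion W (lvl M) (W.zsmul_geomPoints_surjective_holds (lvl_ne_zero M)) x₀' =
        torsionH1ZSMul W 2 (lvl_succ_dvd M) ξ :=
  exists_kummerMapTorsion_eq_of_torsionH1ToH1_eq_zero W M
    (torsionH1ToH1_torsionH1ZSMul_eq_zero W M hdiv' h2 hξ)

end Member

section Twin

variable {θ : K} (hθ : θ ∉ Set.range (algebraMap ℚ K)) (hd : θ ^ 2 = algebraMap ℚ K ((NumberField.discr K : ℤ) : ℚ))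

/-- **Twin: `[2]_* y ∈ Sel^{(2^M)}(E^{(d_K)}/ℚ)`** when `ψ(res y) = δ_{M+1}(x₀)`.
[cite: McCallumLMS1991, §5 Lemma 5.1] [cite: Kolyvagin1989Izv, §3] [cite: DokchitserDokchitserAnnals2010, Lemma 4.14 (proof)] -/
theorem torsionH1ZSMul_twin_mem_selmerGroup_of_hPsiKT_resTorsion_eq_kummer (h2 : Module.finrank ℚ K = 2)
    {y : galH1Torsion (twin W K) (lvl (M + 1))} {x₀ : (W.baseChange K).toAffine.Point}
    (hy : hPsiKT W K hθ hd (lvl (M + 1)) (resTorsion (twin W K) K (lvl (M + 1)) y) =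
      kummerMapTorsion (W.baseChange K) (lvl (M + 1)) hdiv' x₀) :
    torsionH1ZSMul (twin W K) 2 (lvl_succ_dvd M) y ∈ selmerGroup (twin W K) (lvl M) :=
  torsionH1ZSMul_two_mem_selmerGroup_of_resTorsion_mem (twin W K) K h2.le (lvl_succ_dvd M)
    ((mem_selmerGroup_iff_hPsiKT_mem W K hθ hd (lvl (M + 1)) _).mpr (by
      rw [hy]
      exact kummerMapTorsion_mem_selmerGroup (W.baseChange K) _ hdiv' x₀))

/-- **Twin: `ψ(res ([2]_* y)) = δ_M(x₀)`.** [cite: McCallumLMS1991, §4 Lemma 4.6] [cite: Kolyvagin1989Izv, §3] -/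
theorem hPsiKT_resTorsion_torsionH1ZSMul_eq_kummer
    {y : galH1Torsion (twin W K) (lvl (M + 1))} {x₀ : (W.baseChange K).toAffine.Point}
    (hy : hPsiKT W K hθ hd (lvl (M + 1)) (resTorsion (twin W K) K (lvl (M + 1)) y) =
      kummerMapTorsion (W.baseChange K) (lvl (M + 1)) hdiv' x₀) :
    hPsiKT W K hθ hd (lvl M) (resTorsion (twin W K) K (lvl M) (torsionH1ZSMul (twin W K) 2 (lvl_succ_dvd M) y)) =
      kummerMapTorsion (W.baseChange K) (lvl M) hdivM x₀ := by
  rw [hPsiKT_resTorsion_torsionH1ZSMul, hy]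
  exact torsionH1ZSMul_kummerMapTorsion (W.baseChange K) 2 (lvl_mul_two M) hdiv' hdivM x₀

/-- **Twin: `2^{M−1} · [2]_* y ≠ 0`** under the same divisibility hypotheses. [cite: McCallumLMS1991, §5 Lemma 5.1] -/
theorem zsmul_torsionH1ZSMul_twin_ne_zero (hdivM : ∀ Q : geomPoints (W.baseChange K), ∃ R, (lvl M : ℤ) • R = Q)
    (h2t : ∀ T : (W.baseChange K).toAffine.Point, (2 : ℤ) • T = 0 → T = 0) (hM : 1 ≤ M) {y : galH1Torsion (twin W K) (lvl (M + 1))} {x₀ P : (W.baseChange K).toAffine.Point}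
    {M₀ : ℕ}
    (hy : hPsiKT W K hθ hd (lvl (M + 1)) (resTorsion (twin W K) K (lvl (M + 1)) y) =
      kummerMapTorsion (W.baseChange K) (lvl (M + 1)) hdiv' x₀)
    (hx₀ : (((2 : ℕ) : ℤ) ^ M₀) • x₀ = P)
    (hnd : ∀ Q : (W.baseChange K).toAffine.Point, (((2 : ℕ) : ℤ) ^ (M₀ + 1)) • Q ≠ P) :
    (((2 : ℕ) : ℤ) ^ (M - 1)) • torsionH1ZSMul (twin W K) 2 (lvl_succ_dvd M) y ≠ 0 := by
  intro h
  have h1 := congrArg (fun z ↦ hPsiKT W K hθ hd (lvl M) (resTorsion (twin W K) K (lvl M) z)) h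
  simp only [map_zsmul, map_zero] at h1
  rw [hPsiKT_resTorsion_torsionH1ZSMul_eq_kummer W M hdiv' hdivM hθ hd hy, ← map_zsmul] at h1
  have hker : (((2 : ℕ) : ℤ) ^ (M - 1)) • x₀ ∈ (kummerMapTorsion (W.baseChange K) (lvl M) hdivM).ker := h1
  rw [kummerMapTorsion_ker, AddMonoidHom.mem_range] at hker
  obtain ⟨Q, hQ⟩ := hker
  exact zsmul_ne_of_not_two_pow_succ_divisible W h2t hM hx₀ hnd Q hQ

/-- **Twin: `[2]_* y` DIES in `H¹(ℚ, E^{(d_K)})`** when `ψ(res y)` is a Kummer class of `E_K`: the Kummer kernels of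
`E^{(d_K)}_K` and `E_K` correspond under `ψ` (`torsionH1ToH1_hPsiKT_symm_eq_zero_iff`), so the image of `y` restricts to
`0` over `K` and twice it — the image of `[2]_* y` — vanishes over `ℚ`. [cite: SerreGaloisCohomology1997, I.§2.4 Cor. to Prop. 9]
[cite: SilvermanAEC2009, X.4.2 and X.5 Cor. 5.4] -/
theorem torsionH1ToH1_torsionH1ZSMul_twin_eq_zero (h2 : Module.finrank ℚ K = 2)
    {y : galH1Torsion (twin W K) (lvl (M + 1))} {x₀ : (W.baseChange K).toAffine.Point}
    (hy : hPsiKT W K hθ hd (lvl (M + 1)) (resTorsion (twin W K) K (lvl (M + 1)) y) =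
      kummerMapTorsion (W.baseChange K) (lvl (M + 1)) hdiv' x₀) :
    torsionH1ToH1 (twin W K) (lvl M) (torsionH1ZSMul (twin W K) 2 (lvl_succ_dvd M) y) = 0 := by
  have hres : resTorsion (twin W K) K (lvl (M + 1)) y =
      (hPsiKT W K hθ hd (lvl (M + 1))).symm (kummerMapTorsion (W.baseChange K) (lvl (M + 1)) hdiv' x₀) := by
    rw [← hy, AddEquiv.symm_apply_apply]
  have hK0 : torsionH1ToH1 ((twin W K).baseChange K) (lvl (M + 1)) (resTorsion (twin W K) K (lvl (M + 1)) y) = 0 := by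
    rw [hres, torsionH1ToH1_hPsiKT_symm_eq_zero_iff, torsionH1ToH1_kummerMapTorsion]
  have hη : resBaseChange (twin W K) K (torsionH1ToH1 (twin W K) (lvl (M + 1)) y) = 0 := by
    rw [← torsionH1ToH1_resTorsion, hK0]
  have hmem : torsionH1ToH1 (twin W K) (lvl (M + 1)) y ∈ (twin W K).localRestrictionKer K :=
    (mem_ker_resBaseChange_iff (twin W K) K _).mp hη
  have h2η := two_nsmul_mem_localRestrictionKer_of_tower (twin W K) (E := ℚ) h2.le hmem
  rw [WeierstrassCurve.localRestrictionKer_self_eq_bot, AddSubgroup.mem_bot] at h2η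
  rw [torsionH1ToH1_torsionH1ZSMul_two]
  exact h2η

/-- **Twin: `[2]_* y` is a Kummer class over `ℚ`**: `[2]_* y = δ_M(x₀')` for some `x₀' ∈ E^{(d_K)}(ℚ)`.
[cite: SilvermanAEC2009, VIII.§2 and X.4.2] [cite: Kolyvagin1989Izv, §3] -/
theorem exists_rat_point_twin_kummer_eq [(twin W K).IsElliptic] (h2 : Module.finrank ℚ K = 2)
    {y : galH1Torsion (twin W K) (lvl (M + 1))} {x₀ : (W.baseChange K).toAffine.Point}
    (hy : hPsiKT W K hθ hd (lvl (M + 1)) (resTorsion (twin W K) K (lvl (M + 1)) y) =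
      kummerMapTorsion (W.baseChange K) (lvl (M + 1)) hdiv' x₀) :
    ∃ x₀' : (twin W K).toAffine.Point,
      kummerMapTorsion (twin W K) (lvl M) ((twin W K).zsmul_geomPoints_surjective_holds (lvl_ne_zero M)) x₀' =
        torsionH1ZSMul (twin W K) 2 (lvl_succ_dvd M) y :=
  exists_kummerMapTorsion_eq_of_torsionH1ToH1_eq_zero (twin W K) M
    (torsionH1ToH1_torsionH1ZSMul_twin_eq_zero W M hdiv' hθ hd h2 hy)

end Twin

/-! ## §3 `c'(1) = 2^{M₀} ξ` -/

section COne

variable (c : K ≃ₐ[ℚ] K) {S : ℕ → Prop} {P : (W.baseChange K).toAffine.Point}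

/-- **`c'_K(1) = δ_{M+1}(P)`**: the Kolyvagin class of the point system at `n = 1` is the Kummer class of its base
point `P_1 = P` (Gross (4.1): `P_1 = y_K`). [cite: GrossLMS1991, §4 (4.1) and (4.4)] -/
theorem cK_one_eq_kummerMapTorsion (D' : PointSystem N W K P 2 S (M + 1) hdiv' c) :
    cK W c (M + 1) hdiv' D' 1 = kummerMapTorsion (W.baseChange K) (lvl (M + 1)) hdiv' P := by
  have hP1 : toGeomPoints (W.baseChange K) P ∈
      KolyvaginCocycle.invPoints (Field.absoluteGaloisGroup K) (D'.A 1) (lvl (M + 1)) := by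
    rw [← D'.Pt_one]; exact D'.hPt 1
  rw [cK, KolyvaginDescent.kolyvaginClass_congr_point (D'.hA 1) (hP' := hP1) D'.Pt_one]
  exact kolyvaginClass_toGeomPoints (D'.hA 1) P hP1

/-- **`u = 2^{M₀} ξ`** when `res u = δ_{M+1}(P)`, `res ξ = δ_{M+1}(x₀)`, `2^{M₀} x₀ = P` and `E(K)[2^{M+1}] = 0`
(injectivity of `res`): the field `c_one` before `[2]_*`. [cite: McCallumLMS1991, §5 Lemma 5.1] [cite: GrossLMS1991, §5 (5.1)] -/
theorem eq_zsmul_of_resTorsion_eq (h2 : Module.finrank ℚ K = 2) {θ : K} (hθ : θ ∉ Set.range (algebraMap ℚ K))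
    (hd : θ ^ 2 = algebraMap ℚ K ((NumberField.discr K : ℤ) : ℚ))
    (hL : ∀ Q : (W.baseChange K).toAffine.Point, (lvl (M + 1) : ℤ) • Q = 0 → Q = 0)
    {u ξ : galH1Torsion W (lvl (M + 1))} {x₀ P : (W.baseChange K).toAffine.Point} {M₀ : ℕ}
    (hx₀ : (((2 : ℕ) : ℤ) ^ M₀) • x₀ = P)
    (hu : resTorsion W K (lvl (M + 1)) u = kummerMapTorsion (W.baseChange K) (lvl (M + 1)) hdiv' P)
    (hξ : resTorsion W K (lvl (M + 1)) ξ = kummerMapTorsion (W.baseChange K) (lvl (M + 1)) hdiv' x₀) :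
    u = (((2 : ℕ) : ℤ) ^ M₀) • ξ :=
  resTorsion_injective_of_noTorsion W K h2 hθ hd (lvl (M + 1)) hL (by
    rw [map_zsmul, hξ, hu, ← map_zsmul, hx₀])

/-- **Twin: `u = 2^{M₀} y`** when `ψ(res u) = δ_{M+1}(P)`, `ψ(res y) = δ_{M+1}(x₀)`, `2^{M₀} x₀ = P`
(injectivity of `ψ ∘ res`). [cite: McCallumLMS1991, §5 Lemma 5.1] [cite: Kolyvagin1989Izv, §3] -/
theorem eq_zsmul_of_hPsiKT_resTorsion_eq (h2 : Module.finrank ℚ K = 2) {θ : K}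
    (hθ : θ ∉ Set.range (algebraMap ℚ K)) (hd : θ ^ 2 = algebraMap ℚ K ((NumberField.discr K : ℤ) : ℚ))
    (hL : ∀ Q : (W.baseChange K).toAffine.Point, (lvl (M + 1) : ℤ) • Q = 0 → Q = 0)
    {u y : galH1Torsion (twin W K) (lvl (M + 1))} {x₀ P : (W.baseChange K).toAffine.Point} {M₀ : ℕ}
    (hx₀ : (((2 : ℕ) : ℤ) ^ M₀) • x₀ = P)
    (hu : hPsiKT W K hθ hd (lvl (M + 1)) (resTorsion (twin W K) K (lvl (M + 1)) u) =
      kummerMapTorsion (W.baseChange K) (lvl (M + 1)) hdiv' P)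
    (hy : hPsiKT W K hθ hd (lvl (M + 1)) (resTorsion (twin W K) K (lvl (M + 1)) y) =
      kummerMapTorsion (W.baseChange K) (lvl (M + 1)) hdiv' x₀) :
    u = (((2 : ℕ) : ℤ) ^ M₀) • y :=
  resTorsion_twist_injective_of_noTorsion W K h2 hθ hd (lvl (M + 1)) hL
    ((hPsiKT W K hθ hd (lvl (M + 1))).injective (by rw [map_zsmul, map_zsmul, hy, hu, ← map_zsmul, hx₀]))

end COne

end Summit.BirchSwinnertonDyer.BirchSwinnertonDyer.Theorems.KolyvaginPairSupplyTwo

end
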